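import Summits.RiemannHypothesis.RiemannHypothesis.Theorems.WeilFormatCCinfRowCoeffBox
import Summits.RiemannHypothesis.RiemannHypothesis.Theorems.WeilFormatCCinfRowRemainderBox
import Literature.NumberTheory.LFunctions.YoshidaWindowGramColumnData
import HarnessLib

/-!
# Format C, design C∞ (E2, data side): the PRIME-ROW primitive (even sector) — entry boxes of the door's `Prowe n y`, `ρrowe n` and their packed claims

Route context: Fourier–Galerkin / Schur-complement certificates of Weil positivity on a window ("format C", C∞ door
`weilPositivityOn_of_cinf_cert`, `WeilFormatCCinfDoorCert`; supporting stmt-RiemannHypothesis-0098; seat rh-explicit-weil-2,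
cell memos `…/rh-explicit-weil-2/gen16/E2F-CERT-PIPELINE.md` §2 (primitives PR/PRT, RR) and `E2F-EMITTER-SPEC.md` §5).

The row coefficient function `Prowe : ℕ → Fin 4 × Fin D → ℝ` and the row remainder `ρrowe : ℕ → ℝ` that a rung passes to the C∞
door are the lambdas PRINTED in `cinf_facts_even` (`WeilFormatCCinfFactsEven`): `Prowe n (t, e) = (![P₁, 0, 0, P_S] t)(e+1)/m₀^{e+1}`
with `P₁(n,d)`, `P_S(n,d)` the collected fiber sums, and `ρrowe n` the remainder constant.  gen15's kernel boxes enclose exactly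
these pieces: `CinfCoeff.mem_evenRowPureBox` (`P₁`), `mem_evenRowSinBox` (`P_S`) from per-row input boxes `RowInputs`
(`WeilFormatCCinfRowCoeffBox`), and `mem_evenRowRemBox` (`ρrowe`, `WeilFormatCCinfRowRemainderBox`).  This file assembles them
into the pipeline's primitives over the FLATTENED family index `f ↦ finProdFinEquiv.symm f = (f / D, f % D)` (the layout of
`CinfGlue.flat` / `CinfColE.PRN`):

* `CinfPrimR.evenProwBox` / ★ `mem_evenProwBox` — box of `Prowe n (finProdFinEquiv.symm ⟨f, _⟩)` (`0` beyond `4D`), the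
  enclosed function written VERBATIM as the door receives it;
* `evenRhoRowBox` / ★ `mem_evenRhoRowBox` — box of `ρrowe n` (input `RemS ∋` the Stirling/node bracket, `CinfCoeff.mem_remSBox`);
* ★ `prowDataNear_even` (layout `(n, f)`), ★ `prowDataNearT_even` (layout `(f, n)` = `PRN`), ★ `rhoRowDataNear_even` (layout
  `(n, 0)`, a `B × 1` table; `CinfBlocks.VecNear.col0` makes it the vector `RR`) — packed claims from ONE `Encl.checkRect` each,
  ready for `CinfPacked.TabNear.of_dataNear`.

Inputs are hypotheses (`∀ n < B, RowInputsValid S a n ν R (1/(1+4ω_n²)) (X n)` etc.); the odd sector is the same assembly over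
`mem_oddRowPureBox/SinBox/RemBox` with the lambdas of `cinf_facts_odd` (successor).  Bookkeeping over landed evaluators; standard
axioms; no RH claim.
-/

set_option autoImplicit false
-- `Summit.RiemannHypothesis.RiemannHypothesis.…` is the layout-mandated namespace (summit = problem name).
set_option linter.dupNamespace false

open Finset Complex
open scoped Real ArithmeticFunction.vonMangoldt

namespace Summit.RiemannHypothesis.RiemannHypothesis.Theorems.WeilFormatC

namespace CinfPrimR

open Literature.NumberTheory.LFunctions Literature.NumberTheory.LFunctions.Yoshida1992 Literature.Analysis.SpecialFunctions
open Literature.Analysis.ValidatedNumerics Literature.Analysis.ValidatedNumerics.NumericsMP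
open CinfCoeff (RowInputs RowInputsValid evenRowPureBox evenRowSinBox evenRowRemBox mem_evenRowPureBox mem_evenRowSinBox
  mem_evenRowRemBox)

variable {S : ℕ}

/-- Reading a four-vector of functions at a `Fin 4` index through its value. -/
private theorem vec4_apply (g₀ g₁ g₂ g₃ : ℕ → ℝ) (t : Fin 4) :
    (![g₀, g₁, g₂, g₃] : Fin 4 → ℕ → ℝ) t
      = if (t : ℕ) = 0 then g₀ else if (t : ℕ) = 1 then g₁ else if (t : ℕ) = 2 then g₂ else g₃ := by
  fin_cases t <;> rfl

/-! ## The row coefficient entries -/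

/-- **Box of the even row coefficient** `Prowe n (f / D, f % D)` (`0` beyond `f < 4D`): tag `0` → `P₁(n, e+1)/m₀^{e+1}`,
tags `1, 2` → `0`, tag `3` → `P_S(n, e+1)/m₀^{e+1}`, `e = f % D`. -/
def evenProwBox (S : ℕ) (X : ℕ → RowInputs) (a : ℚ) (ν K R J D m₀ n f : ℕ) : MI :=
  if f < 4 * D then
    (if f / D = 0 then evenRowPureBox S (X n) a n ν K R J (f % D + 1)
      else if f / D = 1 then MI.ofInt S 0 else if f / D = 2 then MI.ofInt S 0
      else evenRowSinBox S (X n) n J (f % D + 1)).divNat (m₀ ^ (f % D + 1))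
  else MI.ofInt S 0

variable {a : ℚ} {X : ℕ → RowInputs} {ν K R J D m₀ : ℕ}

/-- ★ **`evenProwBox ∋ Prowe n (finProdFinEquiv.symm f)`** — the door's printed even row coefficient (the lambda of
`cinf_facts_even`, verbatim with `a := (a : ℝ)`), flattened; `0` for `f ≥ 4D`. -/
theorem mem_evenProwBox (hS : 0 < S) (ha : 0 < a) (hm₀ : 0 < m₀) {n : ℕ}
    (hX : RowInputsValid S a n ν R (1 / (1 + 4 * freq (a : ℝ) n ^ 2)) (X n)) (f : ℕ) :
    MI.mem S
      (if h : f < 4 * D then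
        (fun (n : ℕ) (x : Fin 4 × Fin D) ↦ ((![fun d : ℕ ↦ (∑ j ∈ (Finset.range J).filter (fun j ↦ (2 * j + 1) = d),
                        π / 4 * ((-1 : ℝ) ^ n * (n : ℝ) ^ (2 * j)) / Real.pi)
                      + (∑ p ∈ (Finset.Icc 1 K ×ˢ Finset.range J).filter (fun p ↦ p.1 + (2 * p.2 + 1) = d),
                          (fun N : ℕ ↦ (if N % 4 = 1 then (1 : ℝ) else if N % 4 = 3 then -1 else 0)
                      * (1 - 1 / (2 * (N : ℝ))
                          - (∑ l ∈ Finset.Icc 1 ν, (bernoulli (2 * l) : ℝ) / (2 * l) * 16 ^ l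
                              * (((N - 1).choose (2 * l - 1) : ℕ) : ℝ)) / 2)
                      * ((a : ℝ) / (2 * π)) ^ N) p.1
                            * ((-1 : ℝ) ^ n * (n : ℝ) ^ (2 * p.2)) / Real.pi)
                      - (∑ p ∈ (Finset.range R ×ˢ Finset.range J).filter (fun p ↦ (2 * p.1 + 1) + (2 * p.2 + 1) = d),
                          (fun r : ℕ ↦ (-1 : ℝ) ^ r *
                      (∑' l : ℕ, Real.exp (-(2 * (a : ℝ) * digammaNode l)) * digammaNode l ^ (2 * r)) * ((a : ℝ) / π) ^ (2 * r + 1)) p.1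
                            * ((-1 : ℝ) ^ n * (n : ℝ) ^ (2 * p.2)) / Real.pi)
                      + (∑ r ∈ (Finset.range J).filter (fun r ↦ (2 * r + 2) = d),
                          (fun r : ℕ ↦ (-1 : ℝ) ^ n *
                      (-((n : ℝ) ^ (2 * r + 1)) * ((Complex.digamma (1 / 4 + ((freq (a : ℝ) n : ℝ) : ℂ) / 2 * I)).im / 2
                          + (∑ k ∈ weilPrimeIndex (a : ℝ), (Λ k : ℝ) / Real.sqrt k * Real.sin (freq (a : ℝ) n * Real.log k))
                          - archExpSumSin (a : ℝ) n) / π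
                        + 4 / (a : ℝ) * (Real.exp ((a : ℝ) / 2) - Real.exp (-((a : ℝ) / 2))) ^ 2 * (-1 : ℝ) ^ r * ((a : ℝ) ^ 2 / (4 * π ^ 2)) ^ (r + 1)
                          * (1 / (1 + 4 * freq (a : ℝ) n ^ 2)))) r),
                        fun _ ↦ 0, fun _ ↦ 0,
                        fun d : ℕ ↦ ∑ j ∈ (Finset.range J).filter (fun j ↦ (2 * j + 1) = d),
                        ((-1 : ℝ) ^ n * (n : ℝ) ^ (2 * j)) / Real.pi] x.1) ((x.2 : ℕ) + 1) / (m₀ : ℝ) ^ ((x.2 : ℕ) + 1))) n (finProdFinEquiv.symm ⟨f, h⟩)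
       else 0)
      (evenProwBox S X a ν K R J D m₀ n f) := by
  by_cases h : f < 4 * D
  · rw [dif_pos h, evenProwBox, if_pos h, finProdFinEquiv_symm_apply]
    simp only [vec4_apply, Fin.coe_divNat, Fin.coe_modNat]
    have hpow : (0 : ℕ) < m₀ ^ (f % D + 1) := pow_pos hm₀ _
    by_cases h0 : f / D = 0
    · rw [if_pos h0, if_pos h0]
      have h1 := MI.mem_divNat (mem_evenRowPureBox hS ha hX K J (f % D + 1)) hpow
      convert h1 using 2
      norm_cast
    · rw [if_neg h0, if_neg h0]
      by_cases h1 : f / D = 1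
      · rw [if_pos h1, if_pos h1]
        simpa using MI.mem_divNat (MI.mem_ofInt S 0) hpow
      · rw [if_neg h1, if_neg h1]
        by_cases h2 : f / D = 2
        · rw [if_pos h2, if_pos h2]
          simpa using MI.mem_divNat (MI.mem_ofInt S 0) hpow
        · rw [if_neg h2, if_neg h2]
          have h3 := MI.mem_divNat (mem_evenRowSinBox hX J (f % D + 1)) hpow
          convert h3 using 2
          norm_cast
  · rw [dif_neg h, evenProwBox, if_neg h]
    simpa using MI.mem_ofInt S 0

/-! ## The row remainder -/

/-- **Box of the even row remainder** `ρrowe n` (inputs: the row's `RowInputs` for `π`, `1/π`, `s²`, `a²/(4π²)`, `1/(1+4ω_n²)`;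
`RemS ∋` the Stirling/node bracket; `Lam ∋ Σ Λ(k)/√k`; `Rho ∋ ρ(2a)`). -/
def evenRhoRowBox (S : ℕ) (X : ℕ → RowInputs) (RemS Lam Rho : MI) (a : ℚ) (m₀ J n : ℕ) : MI :=
  evenRowRemBox S RemS (X n).P (X n).Pinv Lam Rho (X n).S2 (X n).QQ (X n).Ci a n m₀ J

variable {RemS Lam Rho : MI}

/-- ★ **`evenRhoRowBox ∋ ρrowe n`** — the door's printed even row remainder (the lambda of `cinf_facts_even`, verbatim with
`a := (a : ℝ)`). -/
theorem mem_evenRhoRowBox (hS : 0 < S) (ha : 0 < a) (hm₀ : 0 < m₀) {n : ℕ}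
    (hX : RowInputsValid S a n ν R (1 / (1 + 4 * freq (a : ℝ) n ^ 2)) (X n))
    (hRemS : MI.mem S
      ((4 * Real.pi ^ 2 / 3 * ((2 * ν + 1).factorial : ℝ) / (2 * Real.pi) ^ (2 * ν + 1)
            * (4 * (1 / (4 * (π * m₀ / (a : ℝ) / 2)))) ^ (2 * ν)
          + (1 / (4 * (π * m₀ / (a : ℝ) / 2))) ^ (K + 1) / ((K + 1) * (1 - 1 / (4 * (π * m₀ / (a : ℝ) / 2))))
          + 2 * (1 / (4 * (π * m₀ / (a : ℝ) / 2))) ^ (K + 1)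
          + ∑ k ∈ Finset.Icc 1 ν, |(bernoulli (2 * k) : ℝ) / (2 * k)| * 2 ^ (K + 1 + 4 * k)
              * (1 / (4 * (π * m₀ / (a : ℝ) / 2))) ^ (K + 1)) / 2
        + (∑' k : ℕ, Real.exp (-(2 * (a : ℝ) * digammaNode k)) * digammaNode k ^ (2 * R))
            / |π * m₀ / (a : ℝ)| ^ (2 * R + 1)) RemS)
    (hLam : MI.mem S (∑ k ∈ weilPrimeIndex (a : ℝ), (Λ k : ℝ) / Real.sqrt k) Lam)
    (hRho : MI.mem S (weilArchDensity (2 * (a : ℝ))) Rho) :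
    MI.mem S ((fun n : ℕ ↦ (((4 * Real.pi ^ 2 / 3 * ((2 * ν + 1).factorial : ℝ) / (2 * Real.pi) ^ (2 * ν + 1)
                      * (4 * (1 / (4 * (π * m₀ / (a : ℝ) / 2)))) ^ (2 * ν)
                    + (1 / (4 * (π * m₀ / (a : ℝ) / 2))) ^ (K + 1) / ((K + 1) * (1 - 1 / (4 * (π * m₀ / (a : ℝ) / 2))))
                    + 2 * (1 / (4 * (π * m₀ / (a : ℝ) / 2))) ^ (K + 1)
                    + ∑ k ∈ Finset.Icc 1 ν, |(bernoulli (2 * k) : ℝ) / (2 * k)| * 2 ^ (K + 1 + 4 * k)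
                        * (1 / (4 * (π * m₀ / (a : ℝ) / 2))) ^ (K + 1)) / 2
                  + (∑' k : ℕ, Real.exp (-(2 * (a : ℝ) * digammaNode k)) * digammaNode k ^ (2 * R))
                      / |π * m₀ / (a : ℝ)| ^ (2 * R + 1)) / π
                  * ∑ j ∈ Finset.range J, (n : ℝ) ^ (2 * j) / (m₀ : ℝ) ^ (2 * j + 1)
                + (2 * (π / 4 + (∑ k ∈ weilPrimeIndex (a : ℝ), (Λ k : ℝ) / Real.sqrt k) + (a : ℝ) * (1 + weilArchDensity (2 * (a : ℝ))) / π)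
                      * (n : ℝ) ^ (2 * J) / π
                    + 4 / (a : ℝ) * (Real.exp ((a : ℝ) / 2) - Real.exp (-((a : ℝ) / 2))) ^ 2 * ((a : ℝ) ^ 2 / (4 * π ^ 2)) ^ (J + 1)
                      * (1 / (1 + 4 * freq (a : ℝ) n ^ 2))) / (m₀ : ℝ) ^ (2 * J + 1))) n) (evenRhoRowBox S X RemS Lam Rho a m₀ J n) := by
  have h := mem_evenRowRemBox hS ha hm₀ J hRemS hX.hP hX.hPinv hLam hRho hX.hS2 hX.hQQ hX.hCi (i := n)
  rw [evenRhoRowBox]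
  convert h using 1

/-! ## Packed claims -/

/-- Local copy of `CinfPrimV.dataNear_of_checkRect` (`WeilFormatCCinfCertPrimV`, landed; no farm olean at filing time):
any evaluator with `f i t ∈ box i t` for `i < n`, `t < K` and one passing `Encl.checkRect` give `Encl.DataNear f n K w o c ρ XP`. -/
private theorem dataNear_of_checkRect (hS : 0 < S) {f : ℕ → ℕ → ℝ} {box : ℕ → ℕ → MI} {n K w o c ρ : ℕ} {XP : List ℕ}
    (hbox : ∀ i < n, ∀ t < K, MI.mem S (f i t) (box i t))
    (h : Encl.checkRect S c (ρ : ℤ) w K o box XP 0 n 0 K = true) : Encl.DataNear f n K w o c ρ XP := by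
  have h0 : Encl.DataNear f (0 + n) K w o c ρ XP :=
    Encl.DataNear.extendRows Encl.DataNear.zeroRows fun i _ hi t ht ↦ by
      have h2 := Encl.near_of_checkRect hS (f := f)
        (fun i _ hi t _ ht ↦ hbox i (by simpa using hi) t (by simpa using ht)) h (Nat.zero_le i) hi
        (Nat.zero_le t) (by simpa using ht)
      exact_mod_cast h2
  simpa using h0

variable {B : ℕ}

/-- ★ **Packed claim of the even row coefficients**, layout `(n, f)` (`B` rows, `4D` digits). -/
theorem prowDataNear_even (hS : 0 < S) (ha : 0 < a) (hm₀ : 0 < m₀)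
    (hX : ∀ n < B, RowInputsValid S a n ν R (1 / (1 + 4 * freq (a : ℝ) n ^ 2)) (X n)) {w o cc ρ : ℕ} {XP : List ℕ}
    (h : Encl.checkRect S cc (ρ : ℤ) w (4 * D) o (fun n f ↦ evenProwBox S X a ν K R J D m₀ n f) XP 0 B 0 (4 * D) = true) :
    Encl.DataNear (fun n f ↦ if h : f < 4 * D then
        (fun (n : ℕ) (x : Fin 4 × Fin D) ↦ ((![fun d : ℕ ↦ (∑ j ∈ (Finset.range J).filter (fun j ↦ (2 * j + 1) = d),
                        π / 4 * ((-1 : ℝ) ^ n * (n : ℝ) ^ (2 * j)) / Real.pi)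
                      + (∑ p ∈ (Finset.Icc 1 K ×ˢ Finset.range J).filter (fun p ↦ p.1 + (2 * p.2 + 1) = d),
                          (fun N : ℕ ↦ (if N % 4 = 1 then (1 : ℝ) else if N % 4 = 3 then -1 else 0)
                      * (1 - 1 / (2 * (N : ℝ))
                          - (∑ l ∈ Finset.Icc 1 ν, (bernoulli (2 * l) : ℝ) / (2 * l) * 16 ^ l
                              * (((N - 1).choose (2 * l - 1) : ℕ) : ℝ)) / 2)
                      * ((a : ℝ) / (2 * π)) ^ N) p.1
                            * ((-1 : ℝ) ^ n * (n : ℝ) ^ (2 * p.2)) / Real.pi)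
                      - (∑ p ∈ (Finset.range R ×ˢ Finset.range J).filter (fun p ↦ (2 * p.1 + 1) + (2 * p.2 + 1) = d),
                          (fun r : ℕ ↦ (-1 : ℝ) ^ r *
                      (∑' l : ℕ, Real.exp (-(2 * (a : ℝ) * digammaNode l)) * digammaNode l ^ (2 * r)) * ((a : ℝ) / π) ^ (2 * r + 1)) p.1
                            * ((-1 : ℝ) ^ n * (n : ℝ) ^ (2 * p.2)) / Real.pi)
                      + (∑ r ∈ (Finset.range J).filter (fun r ↦ (2 * r + 2) = d),
                          (fun r : ℕ ↦ (-1 : ℝ) ^ n *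
                      (-((n : ℝ) ^ (2 * r + 1)) * ((Complex.digamma (1 / 4 + ((freq (a : ℝ) n : ℝ) : ℂ) / 2 * I)).im / 2
                          + (∑ k ∈ weilPrimeIndex (a : ℝ), (Λ k : ℝ) / Real.sqrt k * Real.sin (freq (a : ℝ) n * Real.log k))
                          - archExpSumSin (a : ℝ) n) / π
                        + 4 / (a : ℝ) * (Real.exp ((a : ℝ) / 2) - Real.exp (-((a : ℝ) / 2))) ^ 2 * (-1 : ℝ) ^ r * ((a : ℝ) ^ 2 / (4 * π ^ 2)) ^ (r + 1)
                          * (1 / (1 + 4 * freq (a : ℝ) n ^ 2)))) r),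
                        fun _ ↦ 0, fun _ ↦ 0,
                        fun d : ℕ ↦ ∑ j ∈ (Finset.range J).filter (fun j ↦ (2 * j + 1) = d),
                        ((-1 : ℝ) ^ n * (n : ℝ) ^ (2 * j)) / Real.pi] x.1) ((x.2 : ℕ) + 1) / (m₀ : ℝ) ^ ((x.2 : ℕ) + 1))) n (finProdFinEquiv.symm ⟨f, h⟩)
       else 0) B (4 * D) w o cc ρ XP :=
  dataNear_of_checkRect hS (fun n hn f _ ↦ mem_evenProwBox hS ha hm₀ (hX n hn) f) h

/-- ★ **Packed claim of the even row coefficients, TRANSPOSED layout** `(f, n)` (`4D` rows, `B` digits; = `CinfColE.PRN`). -/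
theorem prowDataNearT_even (hS : 0 < S) (ha : 0 < a) (hm₀ : 0 < m₀)
    (hX : ∀ n < B, RowInputsValid S a n ν R (1 / (1 + 4 * freq (a : ℝ) n ^ 2)) (X n)) {w o cc ρ : ℕ} {XP : List ℕ}
    (h : Encl.checkRect S cc (ρ : ℤ) w B o (fun f n ↦ evenProwBox S X a ν K R J D m₀ n f) XP 0 (4 * D) 0 B = true) :
    Encl.DataNear (fun f n ↦ if h : f < 4 * D then
        (fun (n : ℕ) (x : Fin 4 × Fin D) ↦ ((![fun d : ℕ ↦ (∑ j ∈ (Finset.range J).filter (fun j ↦ (2 * j + 1) = d),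
                        π / 4 * ((-1 : ℝ) ^ n * (n : ℝ) ^ (2 * j)) / Real.pi)
                      + (∑ p ∈ (Finset.Icc 1 K ×ˢ Finset.range J).filter (fun p ↦ p.1 + (2 * p.2 + 1) = d),
                          (fun N : ℕ ↦ (if N % 4 = 1 then (1 : ℝ) else if N % 4 = 3 then -1 else 0)
                      * (1 - 1 / (2 * (N : ℝ))
                          - (∑ l ∈ Finset.Icc 1 ν, (bernoulli (2 * l) : ℝ) / (2 * l) * 16 ^ l
                              * (((N - 1).choose (2 * l - 1) : ℕ) : ℝ)) / 2)
                      * ((a : ℝ) / (2 * π)) ^ N) p.1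
                            * ((-1 : ℝ) ^ n * (n : ℝ) ^ (2 * p.2)) / Real.pi)
                      - (∑ p ∈ (Finset.range R ×ˢ Finset.range J).filter (fun p ↦ (2 * p.1 + 1) + (2 * p.2 + 1) = d),
                          (fun r : ℕ ↦ (-1 : ℝ) ^ r *
                      (∑' l : ℕ, Real.exp (-(2 * (a : ℝ) * digammaNode l)) * digammaNode l ^ (2 * r)) * ((a : ℝ) / π) ^ (2 * r + 1)) p.1
                            * ((-1 : ℝ) ^ n * (n : ℝ) ^ (2 * p.2)) / Real.pi)
                      + (∑ r ∈ (Finset.range J).filter (fun r ↦ (2 * r + 2) = d),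
                          (fun r : ℕ ↦ (-1 : ℝ) ^ n *
                      (-((n : ℝ) ^ (2 * r + 1)) * ((Complex.digamma (1 / 4 + ((freq (a : ℝ) n : ℝ) : ℂ) / 2 * I)).im / 2
                          + (∑ k ∈ weilPrimeIndex (a : ℝ), (Λ k : ℝ) / Real.sqrt k * Real.sin (freq (a : ℝ) n * Real.log k))
                          - archExpSumSin (a : ℝ) n) / π
                        + 4 / (a : ℝ) * (Real.exp ((a : ℝ) / 2) - Real.exp (-((a : ℝ) / 2))) ^ 2 * (-1 : ℝ) ^ r * ((a : ℝ) ^ 2 / (4 * π ^ 2)) ^ (r + 1)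
                          * (1 / (1 + 4 * freq (a : ℝ) n ^ 2)))) r),
                        fun _ ↦ 0, fun _ ↦ 0,
                        fun d : ℕ ↦ ∑ j ∈ (Finset.range J).filter (fun j ↦ (2 * j + 1) = d),
                        ((-1 : ℝ) ^ n * (n : ℝ) ^ (2 * j)) / Real.pi] x.1) ((x.2 : ℕ) + 1) / (m₀ : ℝ) ^ ((x.2 : ℕ) + 1))) n (finProdFinEquiv.symm ⟨f, h⟩)
       else 0) (4 * D) B w o cc ρ XP :=
  dataNear_of_checkRect hS (fun f _ n hn ↦ mem_evenProwBox hS ha hm₀ (hX n hn) f) h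

/-- ★ **Packed claim of the even row remainders**, layout `(n, 0)` (a `B × 1` table). -/
theorem rhoRowDataNear_even (hS : 0 < S) (ha : 0 < a) (hm₀ : 0 < m₀)
    (hX : ∀ n < B, RowInputsValid S a n ν R (1 / (1 + 4 * freq (a : ℝ) n ^ 2)) (X n))
    (hRemS : MI.mem S
      ((4 * Real.pi ^ 2 / 3 * ((2 * ν + 1).factorial : ℝ) / (2 * Real.pi) ^ (2 * ν + 1)
            * (4 * (1 / (4 * (π * m₀ / (a : ℝ) / 2)))) ^ (2 * ν)
          + (1 / (4 * (π * m₀ / (a : ℝ) / 2))) ^ (K + 1) / ((K + 1) * (1 - 1 / (4 * (π * m₀ / (a : ℝ) / 2))))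
          + 2 * (1 / (4 * (π * m₀ / (a : ℝ) / 2))) ^ (K + 1)
          + ∑ k ∈ Finset.Icc 1 ν, |(bernoulli (2 * k) : ℝ) / (2 * k)| * 2 ^ (K + 1 + 4 * k)
              * (1 / (4 * (π * m₀ / (a : ℝ) / 2))) ^ (K + 1)) / 2
        + (∑' k : ℕ, Real.exp (-(2 * (a : ℝ) * digammaNode k)) * digammaNode k ^ (2 * R))
            / |π * m₀ / (a : ℝ)| ^ (2 * R + 1)) RemS)
    (hLam : MI.mem S (∑ k ∈ weilPrimeIndex (a : ℝ), (Λ k : ℝ) / Real.sqrt k) Lam)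
    (hRho : MI.mem S (weilArchDensity (2 * (a : ℝ))) Rho) {w o cc ρ : ℕ} {XP : List ℕ}
    (h : Encl.checkRect S cc (ρ : ℤ) w 1 o (fun n _ ↦ evenRhoRowBox S X RemS Lam Rho a m₀ J n) XP 0 B 0 1 = true) :
    Encl.DataNear (fun n _ ↦ (fun n : ℕ ↦ (((4 * Real.pi ^ 2 / 3 * ((2 * ν + 1).factorial : ℝ) / (2 * Real.pi) ^ (2 * ν + 1)
                      * (4 * (1 / (4 * (π * m₀ / (a : ℝ) / 2)))) ^ (2 * ν)
                    + (1 / (4 * (π * m₀ / (a : ℝ) / 2))) ^ (K + 1) / ((K + 1) * (1 - 1 / (4 * (π * m₀ / (a : ℝ) / 2))))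
                    + 2 * (1 / (4 * (π * m₀ / (a : ℝ) / 2))) ^ (K + 1)
                    + ∑ k ∈ Finset.Icc 1 ν, |(bernoulli (2 * k) : ℝ) / (2 * k)| * 2 ^ (K + 1 + 4 * k)
                        * (1 / (4 * (π * m₀ / (a : ℝ) / 2))) ^ (K + 1)) / 2
                  + (∑' k : ℕ, Real.exp (-(2 * (a : ℝ) * digammaNode k)) * digammaNode k ^ (2 * R))
                      / |π * m₀ / (a : ℝ)| ^ (2 * R + 1)) / π
                  * ∑ j ∈ Finset.range J, (n : ℝ) ^ (2 * j) / (m₀ : ℝ) ^ (2 * j + 1)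
                + (2 * (π / 4 + (∑ k ∈ weilPrimeIndex (a : ℝ), (Λ k : ℝ) / Real.sqrt k) + (a : ℝ) * (1 + weilArchDensity (2 * (a : ℝ))) / π)
                      * (n : ℝ) ^ (2 * J) / π
                    + 4 / (a : ℝ) * (Real.exp ((a : ℝ) / 2) - Real.exp (-((a : ℝ) / 2))) ^ 2 * ((a : ℝ) ^ 2 / (4 * π ^ 2)) ^ (J + 1)
                      * (1 / (1 + 4 * freq (a : ℝ) n ^ 2))) / (m₀ : ℝ) ^ (2 * J + 1))) n) B 1 w o cc ρ XP :=
  dataNear_of_checkRect hS (fun n hn _ _ ↦ mem_evenRhoRowBox hS ha hm₀ (hX n hn) hRemS hLam hRho) h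

end CinfPrimR

end Summit.RiemannHypothesis.RiemannHypothesis.Theorems.WeilFormatC
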